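import Mathlib
import HarnessLib
import Literature.AlgebraicGeometry.Resolution.BlowupsIntegral
import Literature.AlgebraicGeometry.Resolution.BlowupsProperProofs
import Summits.ResolutionOfSingularities.ResolutionOfSingularities.Theorems.WildQuotientsWildQuotientResolutionS1aMemberUnitTransfer
import Summits.ResolutionOfSingularities.ResolutionOfSingularities.Theorems.RadicialJungCleanModelsContactChainExit

/-!
# S1a — R4c cusp glue: the pull-back of a nonzero function along a blow-up is nonzero (`hζ : π₁^*ξ_O ≠ 0` of `cusp_killsIn_two`)

[OURS · L1 W4.5c · leafhand-res-wildquotients-7 g1; folklore] — NOT statements of the manuscript; counted 0; AI-level work, weaker than expert review.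
Crux stmt-ResolutionOfSingularities-17941 `CyclicQuotientFourfolds`, line `s1a-logminvertex` v13 (`stub_reachLowerInFX`), R4c `cusp_killsIn_two` (crux-dir skeleton v3:
the hypothesis `hζ` of ✓`associated_sections_of_mul_pow_eq_global` — the GLOBAL normaliser `π₁^*ξ_O` must be nonzero on the integral model `M₁.V`).
* dominance from ✓`RadicialJung.CleanModels.isDominant_of_isBlowup_of_ne_bot` (a blow-up of an integral scheme along `J ≠ ⊥` is dominant);
* ★ `appLE_ne_zero_of_isBlowup` — `X, X′` integral, `X` locally Noetherian, `π : X′ → X` a blow-up along `J ≠ ⊥`: for every nonzero `ζ ∈ Γ(X, U)` and every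
  non-empty open `V ≤ π⁻¹U`, `π.appLE U V ζ ≠ 0` (blow-ups are proper ✓`IsBlowup.isProper`, dominant ⇒ scheme-theoretically dominant ⇒ `π.app U` injective
  (Mathlib `Scheme.Hom.app_injective`), restriction to a non-empty open of an integral scheme injective ✓`map_injective_of_isIntegral`).
-/

set_option linter.dupNamespace false

noncomputable section

universe u

open CategoryTheory AlgebraicGeometry TopologicalSpace Opposite
open Literature.AlgebraicGeometry.Resolution

namespace Summit.ResolutionOfSingularities.ResolutionOfSingularities.Theorems.WildQuotientResolution.S1.BlowupCharts

/-- ★ **The pull-back of a nonzero function along a blow-up is nonzero.** `X′, X` integral, `X` locally Noetherian, `π : X′ → X` a blow-up along an ideal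
sheaf `J ≠ ⊥`; then for every open `U` of `X`, every NON-EMPTY open `V ≤ π⁻¹U` of `X′` and every `ζ ∈ Γ(X, U)` with `ζ ≠ 0`: `π.appLE U V _ ζ ≠ 0`.
[OURS · L1 W4.5c · R4c glue (`hζ`); folklore] -/
theorem appLE_ne_zero_of_isBlowup {X' X : Scheme.{u}} [IsIntegral X'] [IsIntegral X] [IsLocallyNoetherian X]
    {π : X' ⟶ X} {J : X.IdealSheafData} (hπ : IsBlowup π J) (hJ : J ≠ ⊥)
    (U : X.Opens) (V : X'.Opens) (h : V ≤ π ⁻¹ᵁ U) {v : X'} (hv : v ∈ V) {ζ : Γ(X, U)} (hζ : ζ ≠ 0) :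
    π.appLE U V h ζ ≠ 0 := by
  haveI : IsDominant π := RadicialJung.CleanModels.isDominant_of_isBlowup_of_ne_bot hπ hJ
  haveI : IsProper π := hπ.isProper
  haveI : IsSchemeTheoreticallyDominant π := IsSchemeTheoreticallyDominant.of_isDominant π
  intro h0
  have e : π.appLE U V h ζ = (X'.presheaf.map (homOfLE h).op).hom (π.app U ζ) := rfl
  rw [e] at h0
  have h1 : π.app U ζ = 0 := map_injective_of_isIntegral h hv (by rw [h0, map_zero])
  exact hζ (π.app_injective U (by rw [h1, map_zero]))

end Summit.ResolutionOfSingularities.ResolutionOfSingularities.Theorems.WildQuotientResolution.S1.BlowupCharts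

end
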